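import Mathlib
import Summits.Ventures.PercRepro2.RootEdgeCells

/-!
# The root edge, IV: a mixed (two-law) BHK inequality proved by forcing — the `t → 1` extraction
(blind cell PercRepro2, night-3 g21, 2026-08-28; `proofs/NIGHT3-CERT.md` §30.8)

At the root edge `g = {a₁, v}` let `P^s = p[g := s]` and `P_t = p[g := t]`.  BHK06 Thm 1.4 on `P_t`
for the pair `(C(a₂) ∋ v, o ; C(a₁) ∋ b)` reads
`P_t(Q, vH, oH, bL)·P_t(Q) ≤ P_t(Q, vH, oH)·P_t(Q, bL)`.  The event `{Q, v ∈ C₂}` forces `g` closed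
(`P¹(Q, vH) = 0`), so both factors on the left of the products carry the factor `(1 − t)`: the
inequality is `(1 − t)·f(t) ≥ 0` with `f` AFFINE in `t`, hence `f ≥ 0` on `[0, 1)` and, `f` being
affine, `f(1) ≥ 0` — a genuinely two-law inequality between the world `{v ∈ C₂}` of `G − g` and the
contraction `G / g`:

  **`forced_cross`**: `P⁰(Q, vH, oH, bL) · P¹(Q) ≤ P⁰(Q, vH, oH) · P¹(Q, bL)`

(the `(I1)` half of the root-edge cross term `RootCross`, §30.2; the other half
`P¹(Q, bL, oH)·P⁰(Q, vH) ≤ P⁰(Q, vH, bL)·P¹(Q, oH)` is FALSE — 81 / 448 exact random instances —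
so `RootCross` is not a sum of two forced inequalities).  Own work; standard axioms.
-/

namespace Summit.Ventures.PercRepro2

open UnionCluster

namespace CovForm

namespace RootEdge

variable {V : Type*} {E : Type*} [Fintype E] [DecidableEq E] [DecidableEq V]
  {R : Type*} [Field R] [LinearOrder R] [IsStrictOrderedRing R]

omit [Fintype E] [DecidableEq E] [DecidableEq V] [LinearOrder R] [IsStrictOrderedRing R] in
/-- `{C(a₂) ∋ v, o}` is the cluster event of the up-set `{W | v ∈ W ∧ o ∈ W}`. -/
lemma connEvent_inter_eq_clusterInEvent (ends : E → Sym2 V) (a₂ v o : V) :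
    connEvent ends a₂ v ∩ connEvent ends a₂ o = clusterInEvent ends a₂ {W | v ∈ W ∧ o ∈ W} := by
  ext ω
  simp [clusterInEvent]

omit [Fintype E] [DecidableEq V] [LinearOrder R] [IsStrictOrderedRing R] in
/-- `{W | v ∈ W ∧ o ∈ W}` is an up-set. -/
lemma isUpperSet_mem_mem_setOf (v o : V) : IsUpperSet {W : Set V | v ∈ W ∧ o ∈ W} :=
  fun _ _ h hvo => ⟨h hvo.1, h hvo.2⟩

omit [DecidableEq V] [LinearOrder R] [IsStrictOrderedRing R] in
/-- Under `P¹` (the edge `g = {a₁, v}` open) the event `{Q, v ∈ C₂}` is null. -/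
lemma prob_update_one_Q_inter_connV (p : E → R) {ends : E → Sym2 V} {g : E} {a₁ v : V}
    (hg : ends g = s(a₁, v)) (a₂ : V) :
    prob (Function.update p g 1) (avoidAll ends a₂ {a₁} ∩ connEvent ends a₂ v) = 0 := by
  rw [prob_update_one_eq_prob_update_zero p g (Y := ∅) fun ω => ?_, prob_empty]
  rw [← Function.update_idem false true ω, mem_Q_inter_connH_update_true_iff hg]
  simp only [Set.mem_empty_iff_false, iff_false, not_and]
  exact fun _ h => h

omit [DecidableEq V] in
/-- An affine function that is nonnegative on `[0, 1)` is nonnegative at `1`. -/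
lemma affine_nonneg_at_one {α β : R} (h : ∀ t : R, 0 ≤ t → t < 1 → 0 ≤ α + t * β) :
    0 ≤ α + β := by
  by_contra hneg
  have hneg : α + β < 0 := not_le.mp hneg
  have h0 : 0 ≤ α := by simpa using h 0 le_rfl zero_lt_one
  -- `α + β < 0 ≤ α`: take `t` strictly between `α / (α − (α + β))` and `1`
  set c : R := α + β with hc
  have hden : 0 < α - c := by linarith
  set t : R := (α / (α - c) + 1) / 2 with ht
  have ht0 : 0 ≤ α / (α - c) := div_nonneg h0 hden.le
  have ht1 : α / (α - c) < 1 := by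
    rw [div_lt_one hden]; linarith
  have htt0 : 0 ≤ t := by rw [ht]; linarith
  have htt1 : t < 1 := by rw [ht]; linarith
  have key := h t htt0 htt1
  -- `α + t β = (1 − t) α + t c < 0` since `t > α / (α − c)`
  have hsub : α + t * β = (1 - t) * α + t * c := by rw [hc]; ring
  have hgt : α / (α - c) < t := by rw [ht]; linarith
  have : α < t * (α - c) := by
    have := (div_lt_iff₀ hden).1 hgt
    linarith
  linarith

/-- **The forced mixed BHK inequality at a root edge** (`(I1)`): with `P^s = p[g := s]`,
`g = {a₁, v}`, `P⁰(Q, v ∈ C₂, o ∈ C₂, b ∈ C₁) · P¹(Q) ≤ P⁰(Q, v ∈ C₂, o ∈ C₂) · P¹(Q, b ∈ C₁)` —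
BHK06 Thm 1.4 on `p[g := t]` for every `t`, the factor `(1 − t)` of the forced world divided out,
and the affine remainder evaluated at `t = 1`. -/
theorem forced_cross [Fintype V] (ends : E → Sym2 V) (o a₁ a₂ b v : V) {g : E}
    (hg : ends g = s(a₁, v)) (p : E → R) (hp : IsProbVec p) :
    prob (Function.update p g 0)
          (avoidAll ends a₂ {a₁} ∩ (connEvent ends a₂ v ∩ connEvent ends a₂ o) ∩
            connEvent ends a₁ b) *
        prob (Function.update p g 1) (avoidAll ends a₂ {a₁}) ≤
      prob (Function.update p g 0)
          (avoidAll ends a₂ {a₁} ∩ (connEvent ends a₂ v ∩ connEvent ends a₂ o)) *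
        prob (Function.update p g 1) (avoidAll ends a₂ {a₁} ∩ connEvent ends a₁ b) := by
  classical
  -- the four events
  set Q : Set (Config E) := avoidAll ends a₂ {a₁} with hQ
  set U : Set (Config E) := connEvent ends a₂ v ∩ connEvent ends a₂ o with hU
  set bL : Set (Config E) := connEvent ends a₁ b with hbL
  -- under `P¹` the forced events are null
  have hnull : prob (Function.update p g 1) (Q ∩ connEvent ends a₂ v) = 0 :=
    prob_update_one_Q_inter_connV p hg a₂
  have hp1 : IsProbVec (Function.update p g 1) := hp.update g zero_le_one le_rfl
  have hnullU : prob (Function.update p g 1) (Q ∩ U) = 0 := by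
    refine le_antisymm ?_ (prob_nonneg hp1 _)
    rw [← hnull]
    exact prob_mono hp1 (Set.inter_subset_inter_right _ Set.inter_subset_left)
  have hnullUb : prob (Function.update p g 1) (Q ∩ U ∩ bL) = 0 := by
    refine le_antisymm ?_ (prob_nonneg hp1 _)
    rw [← hnullU]
    exact prob_mono hp1 Set.inter_subset_left
  -- BHK 1.4 on `p[g := t]`, pinned
  have hall : ∀ t : R, 0 ≤ t → t ≤ 1 →
      (1 - t) * prob (Function.update p g 0) (Q ∩ U ∩ bL) *
          (t * prob (Function.update p g 1) Q + (1 - t) * prob (Function.update p g 0) Q) ≤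
        (1 - t) * prob (Function.update p g 0) (Q ∩ U) *
          (t * prob (Function.update p g 1) (Q ∩ bL) +
            (1 - t) * prob (Function.update p g 0) (Q ∩ bL)) := by
    intro t ht0 ht1
    have hpt : IsProbVec (Function.update p g t) := hp.update g ht0 ht1
    have h := bhk_cross_cluster_avoid (Function.update p g t) hpt ends a₂ a₁ (X := {a₁})
      (Finset.mem_singleton_self a₁) (isUpperSet_mem_mem_setOf v o) (isUpperSet_mem_setOf b)
    rw [← connEvent_inter_eq_clusterInEvent, ← connEvent_eq_clusterInEvent ends a₁ b] at h
    have e1 : U ∩ bL ∩ Q = Q ∩ U ∩ bL := by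
      rw [hU, hbL, hQ]; ext; simp only [Set.mem_inter_iff]; tauto
    have e2 : U ∩ Q = Q ∩ U := Set.inter_comm _ _
    have e3 : bL ∩ Q = Q ∩ bL := Set.inter_comm _ _
    rw [e1, e2, e3] at h
    -- pin each probability: `P_t = t P¹ + (1 − t) P⁰`
    have pin : ∀ A : Set (Config E), prob (Function.update p g t) A =
        t * prob (Function.update p g 1) A + (1 - t) * prob (Function.update p g 0) A := by
      intro A
      have := prob_eq_pin (Function.update p g t) A g
      rwa [Function.update_idem, Function.update_idem, Function.update_self] at this
    rw [pin, pin, pin, pin, hnullUb, hnullU] at h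
    linarith [h]
  -- divide by `(1 − t)` on `[0, 1)` and let `t → 1`
  have haff : ∀ t : R, 0 ≤ t → t < 1 →
      0 ≤ (prob (Function.update p g 0) (Q ∩ U) * prob (Function.update p g 0) (Q ∩ bL) -
            prob (Function.update p g 0) (Q ∩ U ∩ bL) * prob (Function.update p g 0) Q) +
          t * ((prob (Function.update p g 0) (Q ∩ U) * prob (Function.update p g 1) (Q ∩ bL) -
              prob (Function.update p g 0) (Q ∩ U ∩ bL) * prob (Function.update p g 1) Q) -
            (prob (Function.update p g 0) (Q ∩ U) * prob (Function.update p g 0) (Q ∩ bL) -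
              prob (Function.update p g 0) (Q ∩ U ∩ bL) * prob (Function.update p g 0) Q)) := by
    intro t ht0 ht1
    have h := hall t ht0 ht1.le
    have hpos : 0 < 1 - t := by linarith
    have h' : 0 ≤ (1 - t) * ((prob (Function.update p g 0) (Q ∩ U) *
        (t * prob (Function.update p g 1) (Q ∩ bL) + (1 - t) * prob (Function.update p g 0) (Q ∩ bL))) -
        prob (Function.update p g 0) (Q ∩ U ∩ bL) *
          (t * prob (Function.update p g 1) Q + (1 - t) * prob (Function.update p g 0) Q)) := by
      linarith [h]
    have h'' := (mul_nonneg_iff_of_pos_left hpos).1 h'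
    linarith [h'']
  have := affine_nonneg_at_one haff
  linarith [this]

end RootEdge

end CovForm

end Summit.Ventures.PercRepro2
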